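import Mathlib
import HarnessLib

/-!
# Route `UnitScaleTilt`, crux K1 «MinimiserStabilityRegPr» (stmt-QuantumFields-19200), route-R E′ (A′)-on-Σ, P-A2 (β), row `hMcomb₂` ⟸ H2-1(E) — file H-4 (generic)
# «DUHAMEL FOR AN INHOMOGENEOUS TOWER OF ADDITIVE MAPS»: `E_{k+1} = T_k(E_k) + s_k` ⇒ **`E_l = P_{l←0}(E_0) + Σ_{j<l} P_{l←j+1}(s_j)`**, `P_{l←i} := T_{l−1} ∘ ⋯ ∘ T_i`, and the `ℓ¹`
# triangle inequality over any finite set of evaluation points — ★routeR-w1 g9's MASTER memo §4 telescope `E_l = Σ_{j<l} T_{l−1}∘⋯∘T_{j+1}(rem_j)` as a reusable algebraic letter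

Cell `ym3-torus` (HUMAN RULING D-0037: YM₃ on the torus is ladder rung R3 — not d = 4, not a mass gap, not Clay), width seat `ym3-torus-px17` (gen 4); ★★OWNER RULINGS №20 (1) (`hMcomb₂`),
№22 (c).  `--supports stmt-QuantumFields-19200 --as helper`; THEOREMS ONLY (0 `def`, 0 `sorry`); count-neutral.  Nothing of `hMcomb`, `hMcomb₂`, H2-1, (β), `hPA2`, `hcoS`, E′, EX,
the crux, d = 4 or the gap is claimed.

THE POINT.  H-3c (✓`Prop7CombTildRem2HMcomb2T3`) reduces px13 g6's `hMcomb₂` to H2-1(E): the `ℓ¹` bound over the level-`l` period cell of the second-order defect `E_l` of print's single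
bars, which obeys `E_{l+1}(z,κ) = T_l(E_l)(L•z,κ) + s_l(z,κ)` with ADDITIVE one-step maps `T_l` (the cornered true derivatives, ✓`Prop7CornerCombStructure.trueStep_add`) and sources
`‖s_l(z,κ)‖ ≤ 260·((2d+2)L)²·M₂,l(z,κ)`.  The `ℓ¹` knits (px18 g4 ✓∕⧗`Prop7CornerCombFlatL1Localised`, ★routeR-w1's F-6 dressing) bound HOMOGENEOUS towers started at a given level.  The
bridge is Duhamel's formula for towers of additive maps on an additive commutative group — pure algebra, stated here once with the two-index propagator family `P` tied to `T` by
recursion TEXTS (`P i i = id`, `P (l+1) i = T_l ∘ P l i` for `i ≤ l`; existence §1), the identity (§2), its pointwise evaluation for function-valued towers and the `ℓ¹` triangle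
inequality over any finite set of points (§3).  With `s_k := E_{k+1} − T_k(E_k)` the recursion hypothesis is automatic (§2 `duhamel_defect`), so the member instantiation needs no
further input.

WHAT IS PROVED (ns `…Theorems.Prop7LinearTowerDuhamel`; any `AddCommGroup`, resp. `SeminormedAddCommGroup`).
* §1 `exists_propagator` (the two-index family), `propagator_add` (each `P l i` is additive when the `T_k` are), `propagator_zero`.
* §2 ★★ `duhamel` (`E l = P l 0 (E 0) + Σ_{j ∈ range l} P l (j+1) (s j)`), `duhamel_defect` (the same with `s k := E (k+1) − T k (E k)`, no hypothesis on `E`).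
* §3 ★★ `duhamel_apply₂` (pointwise, for towers of two-argument functions), ★★★ `sum_norm_le_of_duhamel₂` (`Σ_{p ∈ Z}‖E l p.1 p.2‖ ≤ Σ_{p∈Z}‖P l 0 (E 0) p.1 p.2‖ + Σ_{j<l}Σ_{p∈Z}‖P l (j+1) (s j) p.1 p.2‖`).
HONEST SCOPE.  Algebra and the triangle inequality; no lattice, no member, no estimate of any propagator.  Rung R3, not Clay; YM gap NOT proved.

References: T. Bałaban, CMP **98** (1985) 17–51 [Balaban1985Averaging] ((68)–(69) p.29, (119)–(122) pp.35–36); CMP **109** (1987) 249–301 [Balaban1987RG1] ((0.4) p.253);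
folklore (Duhamel ∕ variation of constants for linear recursions).
-/

set_option autoImplicit false

open scoped BigOperators

namespace Summit.QuantumFields.YangMills.Theorems.Prop7LinearTowerDuhamel

/-! ## §1 The two-index propagator family -/

section Propagator

variable {V : Type*}

/-- **The propagators exist**: for any one-step maps `T_k` there is a two-index family `P` with `P i i = id` and `P (l+1) i = T_l ∘ P l i` for `i ≤ l` (`P l i` for `i > l` is junk).
[folklore] -/
theorem exists_propagator (T : ℕ → V → V) :
    ∃ P : ℕ → ℕ → V → V, (∀ i x, P i i x = x) ∧ ∀ l i x, i ≤ l → P (l + 1) i x = T l (P l i x) := by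
  classical
  refine ⟨fun l => Nat.rec (motive := fun _ => ℕ → V → V) (fun _ x => x) (fun l Pl => fun i x => if i ≤ l then T l (Pl i x) else x) l, ?_, ?_⟩
  · intro i x
    cases i with
    | zero => rfl
    | succ i =>
      show (if i + 1 ≤ i then _ else x) = x
      rw [if_neg (by omega)]
  · intro l i x hil
    show (if i ≤ l then T l _ else x) = T l _
    rw [if_pos hil]

variable [AddCommGroup V]

/-- **Each propagator is additive** when every one-step map is. [folklore] -/
theorem propagator_add (T : ℕ → V → V) (hT : ∀ k x y, T k (x + y) = T k x + T k y)
    (P : ℕ → ℕ → V → V) (hP0 : ∀ i x, P i i x = x) (hPs : ∀ l i x, i ≤ l → P (l + 1) i x = T l (P l i x))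
    (i : ℕ) : ∀ l, i ≤ l → ∀ x y, P l i (x + y) = P l i x + P l i y := by
  intro l hl
  induction l, hl using Nat.le_induction with
  | base => intro x y; rw [hP0, hP0, hP0]
  | succ l hil ih => intro x y; rw [hPs l i _ hil, hPs l i _ hil, hPs l i _ hil, ih, hT]

/-- **Each propagator maps `0` to `0`** when every one-step map is additive. [folklore] -/
theorem propagator_zero (T : ℕ → V → V) (hT : ∀ k x y, T k (x + y) = T k x + T k y)
    (P : ℕ → ℕ → V → V) (hP0 : ∀ i x, P i i x = x) (hPs : ∀ l i x, i ≤ l → P (l + 1) i x = T l (P l i x))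
    (i l : ℕ) (hil : i ≤ l) : P l i 0 = 0 := by
  have h := propagator_add T hT P hP0 hPs i l hil 0 0
  rw [add_zero] at h
  -- `P 0 = P 0 + P 0`
  have : P l i 0 + P l i 0 = P l i 0 + 0 := by rw [add_zero]; exact h.symm
  exact add_left_cancel this

end Propagator

/-! ## §2 ★★ Duhamel's formula -/

section Duhamel

variable {V : Type*} [AddCommGroup V]

/-- An additive one-step map commutes with finite sums. [folklore] -/
theorem map_finset_sum_of_add (f : V → V) (hf : ∀ x y, f (x + y) = f x + f y) {ι : Type*} (S : Finset ι) (g : ι → V) :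
    f (∑ j ∈ S, g j) = ∑ j ∈ S, f (g j) :=
  map_sum (AddMonoidHom.mk' f hf) g S

/-- ★★ **DUHAMEL'S FORMULA FOR A TOWER OF ADDITIVE MAPS**: if `E_{k+1} = T_k(E_k) + s_k` with every `T_k` additive, then for every `l`,
`E_l = P_{l←0}(E_0) + Σ_{j<l} P_{l←j+1}(s_j)` (`P` any family with the propagator texts). [folklore; cite: Balaban1985Averaging, (68)-(69) p.29, (122) p.36] -/
theorem duhamel (T : ℕ → V → V) (hT : ∀ k x y, T k (x + y) = T k x + T k y)
    (P : ℕ → ℕ → V → V) (hP0 : ∀ i x, P i i x = x) (hPs : ∀ l i x, i ≤ l → P (l + 1) i x = T l (P l i x))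
    (E s : ℕ → V) (hE : ∀ k, E (k + 1) = T k (E k) + s k) :
    ∀ l : ℕ, E l = P l 0 (E 0) + ∑ j ∈ Finset.range l, P l (j + 1) (s j) := by
  intro l
  induction l with
  | zero => simp [hP0]
  | succ l ih =>
    rw [hE l, ih, hT, map_finset_sum_of_add (T l) (hT l), Finset.sum_range_succ, hP0, ← hPs l 0 _ (Nat.zero_le l)]
    have hsum : ∑ j ∈ Finset.range l, T l (P l (j + 1) (s j)) = ∑ j ∈ Finset.range l, P (l + 1) (j + 1) (s j) :=
      Finset.sum_congr rfl fun j hj => by rw [hPs l (j + 1) _ (by simpa using Finset.mem_range.1 hj)]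
    rw [hsum, add_assoc]

/-- ★★ **DUHAMEL WITH THE DEFECT AS SOURCE**: for ANY sequence `E`, with `s_k := E_{k+1} − T_k(E_k)`, `E_l = P_{l←0}(E_0) + Σ_{j<l} P_{l←j+1}(E_{j+1} − T_j(E_j))` — no hypothesis on `E`.
[folklore; cite: Balaban1985Averaging, (68)-(69) p.29] -/
theorem duhamel_defect (T : ℕ → V → V) (hT : ∀ k x y, T k (x + y) = T k x + T k y)
    (P : ℕ → ℕ → V → V) (hP0 : ∀ i x, P i i x = x) (hPs : ∀ l i x, i ≤ l → P (l + 1) i x = T l (P l i x)) (E : ℕ → V) (l : ℕ) :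
    E l = P l 0 (E 0) + ∑ j ∈ Finset.range l, P l (j + 1) (E (j + 1) - T j (E j)) :=
  duhamel T hT P hP0 hPs E (fun k => E (k + 1) - T k (E k)) (fun k => by rw [add_sub_cancel]) l

end Duhamel

/-! ## §3 Function-valued towers: pointwise evaluation and the `ℓ¹` triangle inequality -/

section Pointwise

variable {X Y A : Type*} [SeminormedAddCommGroup A]

/-- ★★ **POINTWISE DUHAMEL** for a tower of two-argument functions (fields `x ↦ μ ↦ a`): the identity of `duhamel_defect` evaluated at `(x, μ)`, the finite sum passing through
evaluation. [folklore] -/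
theorem duhamel_apply₂ (T : ℕ → (X → Y → A) → X → Y → A) (hT : ∀ k f g, T k (f + g) = T k f + T k g)
    (P : ℕ → ℕ → (X → Y → A) → X → Y → A) (hP0 : ∀ i f, P i i f = f) (hPs : ∀ l i f, i ≤ l → P (l + 1) i f = T l (P l i f))
    (E : ℕ → X → Y → A) (l : ℕ) (x : X) (μ : Y) :
    E l x μ = P l 0 (E 0) x μ + ∑ j ∈ Finset.range l, P l (j + 1) (E (j + 1) - T j (E j)) x μ := by
  have h := duhamel_defect T hT P hP0 hPs E l
  have hx := congrFun (congrFun h x) μ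
  rw [hx, Pi.add_apply, Pi.add_apply, Finset.sum_apply, Finset.sum_apply]

/-- ★★★ **THE `ℓ¹` TRIANGLE INEQUALITY OF DUHAMEL'S FORMULA OVER ANY FINITE SET OF POINTS**: `Σ_{p∈Z}‖E_l(p)‖ ≤ Σ_{p∈Z}‖P_{l←0}(E_0)(p)‖ + Σ_{j<l}Σ_{p∈Z}‖P_{l←j+1}(E_{j+1} − T_j E_j)(p)‖`
— the «tied-source» interface of H2-1(E): the left side is H-3c's `hE` row at `Z :=` the level-`l` period cell, each right summand a HOMOGENEOUS propagation of one level's defect.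
[folklore; cite: Balaban1985Averaging, (68)-(69) p.29, (122)-(126) p.36] -/
theorem sum_norm_le_of_duhamel₂ (T : ℕ → (X → Y → A) → X → Y → A) (hT : ∀ k f g, T k (f + g) = T k f + T k g)
    (P : ℕ → ℕ → (X → Y → A) → X → Y → A) (hP0 : ∀ i f, P i i f = f) (hPs : ∀ l i f, i ≤ l → P (l + 1) i f = T l (P l i f))
    (E : ℕ → X → Y → A) (l : ℕ) (Z : Finset (X × Y)) :
    ∑ p ∈ Z, ‖E l p.1 p.2‖
      ≤ ∑ p ∈ Z, ‖P l 0 (E 0) p.1 p.2‖ + ∑ j ∈ Finset.range l, ∑ p ∈ Z, ‖P l (j + 1) (E (j + 1) - T j (E j)) p.1 p.2‖ := by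
  rw [Finset.sum_comm, ← Finset.sum_add_distrib]
  refine Finset.sum_le_sum fun p _ => ?_
  rw [duhamel_apply₂ T hT P hP0 hPs E l p.1 p.2]
  exact (norm_add_le _ _).trans (add_le_add le_rfl (norm_sum_le _ _))

end Pointwise

end Summit.QuantumFields.YangMills.Theorems.Prop7LinearTowerDuhamel
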